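import Mathlib.Analysis.SpecialFunctions.Trigonometric.InverseDeriv
import Mathlib.Topology.MetricSpace.Thickening
import Literature.Analysis.PDE.SymmHyperbolicSmoothFamilies
import Literature.Analysis.PDE.SymmHyperbolicLocalExistenceDim
import Literature.Analysis.Calculus.SeeleyExtensionTorusFamilies
import Literature.Analysis.FunctionSpaces.TorusSpaceTime
import HarnessLib

/-!
# ParameterAsDimension (DimLift `[X₄]` door; decomp-a2c lens-1 g43, critic row 571 (2)(iv)) —
# `symmHyperbolic_smoothFamilies ⟸ [X₄] SymmHyperbolicLocalExistenceDim 4`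

(Unrelated to, and sharing no declaration with, the dormant route `Theses/DimensionLadder.lean`
«let the dimension do the mixing»; here the "ladder" is the space dimension of ONE auxiliary PDE.)

NODE (grading lens, grade = space dimension `d`):

  `Literature.Analysis.PDE.symmHyperbolic_smoothFamilies`  (smooth one-parameter FAMILIES on `𝕋³`)
    ⟸  `SymmHyperbolicLocalExistenceDim 4`                  (ONE smooth datum on `𝕋⁴`)   — door PROVED below.

Rungs: `SymmHyperbolicLocalExistenceDim 3` is the tree theorem
`Literature.Analysis.PDE.symmHyperbolicLocalExistence_matrix` (PROVED, 0 sorry); the generic-`d`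
statement is Kato 1975 Thm II / Majda 1984 Thm 2.1 / Rendall 2008 §8.3 pp. 178–183 (any `d`:
`H^k` data, `k > d/2 + 1`, `C^∞` data give `C^∞` solutions), absent from the tree for `d ≠ 3`
because ONE lemma of the quasilinear chain is typed at `Fintype.card ι = 3`
(`exists_norm_sq_le_twordEnergy_two`, the word-form Sobolev embedding `H² ⊂ L^∞` with margin 2);
its generic form is `Literature.Analysis.FunctionSpaces.Torus.WordSupEmbedding ι σ` for
`card ι < 2σ` (`TorusWordSupEmbedding`); `[X_d]` itself is `SymmHyperbolicLocalExistenceDim`.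

Door mechanism ("parameter as a fourth space variable", folklore; e.g. the standard remark that
smooth dependence on parameters follows from the parameter-free theorem applied on `M × P`):
(A) Seeley-extend the data family `m ↦ V₀ m` from `[0,1]` to all `m ∈ ℝ` at torus level
(`Literature.Analysis.Calculus.DimLift.exists_isSmoothSpaceTimeOn_univ_extension`,
`SeeleyExtensionTorusFamilies`);
(B) a compact `K' ⊆ O` still contains the extended data for `m ∈ [-ε, 1+ε]`;
(C) wrap the parameter around a circle, `m = g_ε(ϑ) = ½ + (½+ε) cos 2πϑ`, and solve ONE symmetric
hyperbolic system on `𝕋⁴ = 𝕋³ × 𝕋¹` with `A₄ ≡ 0` and datum `(x, ϑ) ↦ W (g_ε ϑ) x`;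
(D) read the family back on the slices `ϑ = θ_ε(m) = arccos((m-½)/(½+ε))/2π` (smooth for
`m ∈ [0,1]` since `|(m-½)/(½+ε)| < 1`): with `A₄ ≡ 0` the 4-D equation AT a slice point IS the
member equation (no uniqueness / finite propagation speed needed), the initial value is
`W (g_ε (θ_ε m)) = W m = V₀ m`, and joint smoothness in `(m, t, x)` is composition with the smooth
4-D solution.
Sources: Kato 1975 Thms II–III (`Kato1975`), Hörmander 1997 §4.2 p. 54 (parameter principle,
`Hormander1997`). All helpers (B), (C) are private plumbing; the public theorems are the door
`symmHyperbolic_smoothFamilies_of_dim4` and `parameterAsDimension_ladder`.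
-/

noncomputable section

open Set Filter Function Matrix Metric
open scoped ContDiff Topology

namespace Literature.Analysis.PDE

open Literature.Analysis.FunctionSpaces Literature.Analysis.FunctionSpaces.Torus
open Literature.Analysis.Calculus

/-! ## (B) compact range is kept for parameters slightly outside `[0, 1]` -/

namespace DimLift

variable {d : Type*} [Fintype d] {N : ℕ}

/-- If a jointly continuous family has `W m x ∈ K` (compact, `K ⊆ O` open) for `m ∈ [0,1]`, then
for some `ε > 0` and some compact `K' ⊆ O`, `W m x ∈ K'` for all `m ∈ [-ε, 1+ε]` (closed
thickening of `K` inside `O` + the tube lemma over the compact torus at `m = 0, 1`). [folklore] -/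
private theorem exists_compact_range_nhds {O K : Set (EuclideanSpace ℝ (Fin N))} (hO : IsOpen O)
    (hK : IsCompact K) (hKO : K ⊆ O) {W : ℝ → UnitAddTorus d → EuclideanSpace ℝ (Fin N)}
    (hW : IsSmoothSpaceTimeOn univ W) (hWK : ∀ m ∈ Icc (0 : ℝ) 1, ∀ x, W m x ∈ K) :
    ∃ ε : ℝ, 0 < ε ∧ ∃ K' : Set (EuclideanSpace ℝ (Fin N)), IsCompact K' ∧ K' ⊆ O ∧
      ∀ m ∈ Icc (-ε) (1 + ε), ∀ x, W m x ∈ K' := by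
  obtain ⟨r, hr, hrO⟩ := hK.exists_cthickening_subset_open hO hKO
  have h0 : ∀ᶠ s in 𝓝 (0 : ℝ), ∀ x, ‖W s x - W 0 x‖ < r := by
    simpa [nhdsWithin_univ] using hW.eventually_norm_sub_lt (mem_univ 0) hr
  have h1 : ∀ᶠ s in 𝓝 (1 : ℝ), ∀ x, ‖W s x - W 1 x‖ < r := by
    simpa [nhdsWithin_univ] using hW.eventually_norm_sub_lt (mem_univ 1) hr
  obtain ⟨ε₀, hε₀, h0'⟩ := Metric.eventually_nhds_iff.1 h0
  obtain ⟨ε₁, hε₁, h1'⟩ := Metric.eventually_nhds_iff.1 h1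
  refine ⟨min ε₀ ε₁ / 2, by positivity, cthickening r K, hK.cthickening, hrO, fun m hm x => ?_⟩
  have hε : min ε₀ ε₁ / 2 < ε₀ := by
    have := min_le_left ε₀ ε₁; linarith
  have hε' : min ε₀ ε₁ / 2 < ε₁ := by
    have := min_le_right ε₀ ε₁; linarith
  by_cases hm0 : m < 0
  · have hd0 : dist m 0 < ε₀ := by
      rw [Real.dist_eq, sub_zero, abs_of_neg hm0]; linarith [hm.1]
    exact mem_cthickening_of_dist_le _ _ _ _ (hWK 0 ⟨le_rfl, zero_le_one⟩ x)
      (by rw [dist_eq_norm]; exact (h0' hd0 x).le)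
  by_cases hm1 : 1 < m
  · have hd1 : dist m 1 < ε₁ := by
      rw [Real.dist_eq, abs_of_pos (by linarith)]; linarith [hm.2]
    exact mem_cthickening_of_dist_le _ _ _ _ (hWK 1 ⟨zero_le_one, le_rfl⟩ x)
      (by rw [dist_eq_norm]; exact (h1' hd1 x).le)
  exact self_subset_cthickening _ (hWK m ⟨not_lt.1 hm0, not_lt.1 hm1⟩ x)

end DimLift


/-! ## (C) wrapping the parameter around a circle; `𝕋⁴ = 𝕋³ × 𝕋¹` slices -/

namespace DimLift

/-- `ϑ ↦ cos 2πϑ` on the unit circle `ℝ/ℤ`. [folklore] -/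
private def cosC : UnitAddCircle → ℝ :=
  Function.Periodic.lift (f := fun t : ℝ => Real.cos (2 * Real.pi * t)) (c := (1 : ℝ))
    (fun t => by simp only [mul_add, mul_one]; exact Real.cos_add_two_pi _)

/-- `cosC` on representatives. [folklore] -/
private theorem cosC_coe (t : ℝ) : cosC ((t : ℝ) : UnitAddCircle) = Real.cos (2 * Real.pi * t) :=
  Function.Periodic.lift_coe _ t

/-- The parameter as a function on the circle: `g_ε(ϑ) = ½ + (½ + ε) cos 2πϑ` (onto `[-ε, 1+ε]`). [folklore] -/
private def gPar (ε : ℝ) (θ : UnitAddCircle) : ℝ := 1 / 2 + (1 / 2 + ε) * cosC θ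

/-- A smooth right inverse of `g_ε` on `[0, 1]`: `θ_ε(m) = arccos((m - ½)/(½ + ε)) / 2π`. [folklore] -/
private def thetaPar (ε m : ℝ) : ℝ := Real.arccos ((m - 1 / 2) / (1 / 2 + ε)) / (2 * Real.pi)

/-- `θ_ε(m)` as a point of the circle. [folklore] -/
private def thetaC (ε m : ℝ) : UnitAddCircle := ((thetaPar ε m : ℝ) : UnitAddCircle)

/-- `g_ε` takes values in `[-ε, 1+ε]`. [folklore] -/
private theorem gPar_mem {ε : ℝ} (hε : 0 ≤ ε) (θ : UnitAddCircle) : gPar ε θ ∈ Icc (-ε) (1 + ε) := by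
  obtain ⟨t, rfl⟩ := QuotientAddGroup.mk_surjective θ
  have h := cosC_coe t
  simp only [gPar, mem_Icc]
  rw [h]
  constructor <;> nlinarith [Real.neg_one_le_cos (2 * Real.pi * t), Real.cos_le_one (2 * Real.pi * t)]

/-- `g_ε (θ_ε m) = m` for `m ∈ [0, 1]`. [folklore] -/
private theorem gPar_thetaC {ε : ℝ} (hε : 0 ≤ ε) {m : ℝ} (hm : m ∈ Icc (0 : ℝ) 1) :
    gPar ε (thetaC ε m) = m := by
  have hpos : 0 < 1 / 2 + ε := by positivity
  have hu1 : -1 ≤ (m - 1 / 2) / (1 / 2 + ε) := by rw [le_div_iff₀ hpos]; linarith [hm.1]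
  have hu2 : (m - 1 / 2) / (1 / 2 + ε) ≤ 1 := by rw [div_le_iff₀ hpos]; linarith [hm.2]
  unfold gPar thetaC thetaPar
  rw [cosC_coe]
  have hπ : 2 * Real.pi * (Real.arccos ((m - 1 / 2) / (1 / 2 + ε)) / (2 * Real.pi)) =
      Real.arccos ((m - 1 / 2) / (1 / 2 + ε)) := by
    rw [mul_comm]
    exact div_mul_cancel₀ _ (by positivity)
  rw [hπ, Real.cos_arccos hu1 hu2]
  have hne : (1 / 2 + ε : ℝ) ≠ 0 := hpos.ne'
  field_simp
  ring

/-- `θ_ε` is smooth at every `m ∈ [0, 1]` (`|(m-½)/(½+ε)| < 1`). [folklore] -/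
private theorem contDiffAt_thetaPar {ε : ℝ} (hε : 0 < ε) {m : ℝ} (hm : m ∈ Icc (0 : ℝ) 1) :
    ContDiffAt ℝ ∞ (thetaPar ε) m := by
  have hpos : 0 < 1 / 2 + ε := by positivity
  have hu1 : -1 < (m - 1 / 2) / (1 / 2 + ε) := by rw [lt_div_iff₀ hpos]; linarith [hm.1]
  have hu2 : (m - 1 / 2) / (1 / 2 + ε) < 1 := by rw [div_lt_iff₀ hpos]; linarith [hm.2]
  unfold thetaPar
  exact ((Real.contDiffAt_arccos hu1.ne' hu2.ne).comp m
    ((contDiffAt_id.sub contDiffAt_const).div_const _)).div_const _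

/-- `𝕋³ × 𝕋¹ → 𝕋⁴`: append a circle coordinate. [folklore] -/
private def snocT (x : UnitAddTorus (Fin 3)) (θ : UnitAddCircle) : UnitAddTorus (Fin 4) :=
  (Fin.snoc x θ : Fin 4 → UnitAddCircle)

/-- `ℝ³ × ℝ → ℝ⁴`: append a coordinate. [folklore] -/
private def snocE (y : EuclideanSpace ℝ (Fin 3)) (s : ℝ) : EuclideanSpace ℝ (Fin 4) :=
  WithLp.toLp 2 (Fin.snoc (WithLp.ofLp y) s : Fin 4 → ℝ)

/-- `ℝ⁴ → ℝ³`: forget the last coordinate. [folklore] -/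
private def initE (z : EuclideanSpace ℝ (Fin 4)) : EuclideanSpace ℝ (Fin 3) :=
  WithLp.toLp 2 (fun j : Fin 3 => z (Fin.castSucc j))

/-- Last coordinate of `snocT`. [folklore] -/
@[simp] private theorem snocT_last (x : UnitAddTorus (Fin 3)) (θ : UnitAddCircle) :
    snocT x θ (Fin.last 3) = θ := by
  simp only [snocT, Fin.snoc_last]

/-- First three coordinates of `snocT`. [folklore] -/
@[simp] private theorem snocT_castSucc (x : UnitAddTorus (Fin 3)) (θ : UnitAddCircle) (j : Fin 3) :
    snocT x θ (Fin.castSucc j) = x j := by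
  simp only [snocT, Fin.snoc_castSucc]

/-- `Fin.init ∘ snocT`. [folklore] -/
@[simp] private theorem init_snocT (x : UnitAddTorus (Fin 3)) (θ : UnitAddCircle) :
    Fin.init (snocT x θ) = x := by
  funext j
  simp [Fin.init]

/-- `proj` commutes with appending a coordinate. [folklore] -/
private theorem proj_snocE (y : EuclideanSpace ℝ (Fin 3)) (s : ℝ) :
    proj (snocE y s) = snocT (proj y) ((s : ℝ) : UnitAddCircle) := by
  funext i
  refine Fin.lastCases ?_ (fun j => ?_) i
  · simp only [snocE, snocT, proj_apply, Fin.snoc_last]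
  · simp only [snocE, snocT, proj_apply, Fin.snoc_castSucc]

/-- `proj (snocE y (θ_ε m)) = snocT (proj y) (thetaC ε m)`. [folklore] -/
private theorem proj_snocE_thetaPar (y : EuclideanSpace ℝ (Fin 3)) (ε m : ℝ) :
    proj (snocE y (thetaPar ε m)) = snocT (proj y) (thetaC ε m) :=
  proj_snocE y _

/-- `proj` commutes with forgetting the last coordinate. [folklore] -/
private theorem proj_initE (z : EuclideanSpace ℝ (Fin 4)) : proj (initE z) = Fin.init (proj z) := by
  funext j
  simp [initE, proj_apply, Fin.init]

/-- `snocE` is smooth. [folklore] -/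
private theorem contDiff_snocE : ContDiff ℝ ∞ (fun q : EuclideanSpace ℝ (Fin 3) × ℝ => snocE q.1 q.2) := by
  refine contDiff_euclidean.2 fun i => ?_
  refine Fin.lastCases ?_ (fun j => ?_) i
  · simp only [snocE, PiLp.toLp_apply, Fin.snoc_last]
    exact contDiff_snd
  · simp only [snocE, PiLp.toLp_apply, Fin.snoc_castSucc]
    exact contDiff_euclidean.1 contDiff_fst j

/-- `initE` is smooth. [folklore] -/
private theorem contDiff_initE : ContDiff ℝ ∞ initE :=
  contDiff_euclidean.2 fun j => by
    simpa [initE] using contDiff_euclidean.1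
      (contDiff_id (𝕜 := ℝ) (E := EuclideanSpace ℝ (Fin 4))) (Fin.castSucc j)

section Slice

variable {F : Type*} [NormedAddCommGroup F] [NormedSpace ℝ F]

/-- Translating the `𝕋³`-argument of a slice = translating in `𝕋⁴` along the first three axes. [folklore] -/
private theorem snocT_add_proj (x : UnitAddTorus (Fin 3)) (θ : UnitAddCircle) (s : ℝ) (k : Fin 3) :
    snocT (x + proj (s • EuclideanSpace.single k (1 : ℝ))) θ =
      snocT x θ + proj (s • EuclideanSpace.single (Fin.castSucc k) (1 : ℝ)) := by
  funext i
  refine Fin.lastCases ?_ (fun j => ?_) i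
  · have h0 : EuclideanSpace.single (Fin.castSucc k) (1 : ℝ) (Fin.last 3) = 0 :=
      PiLp.single_eq_of_ne' 2 (Fin.castSucc_lt_last k).ne 1
    simp only [snocT, Fin.snoc_last, Pi.add_apply, proj_apply, PiLp.smul_apply, h0, smul_zero,
      QuotientAddGroup.mk_zero, add_zero]
  · simp [snocT, proj_apply, Fin.castSucc_inj]

/-- **Slice rule for space derivatives**: the `k`-th partial derivative (`k < 3`) of the slice
`x ↦ f (x, θ)` is the `k`-th partial derivative of `f` on `𝕋⁴` at the slice point. [folklore] -/
private theorem partialDeriv_slice (f : UnitAddTorus (Fin 4) → F) (θ : UnitAddCircle) (k : Fin 3)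
    (x : UnitAddTorus (Fin 3)) :
    partialDeriv k (fun x' => f (snocT x' θ)) x = partialDeriv (Fin.castSucc k) f (snocT x θ) := by
  unfold partialDeriv Torus.lineDeriv
  refine congrArg (fun g : ℝ → F => deriv g 0) (funext fun s => ?_)
  show f (snocT (x + proj (s • EuclideanSpace.single k (1 : ℝ))) θ) =
    f (snocT x θ + proj (s • EuclideanSpace.single (Fin.castSucc k) (1 : ℝ)))
  rw [snocT_add_proj]

/-- Slice rule for the time derivative (definitional). [folklore] -/
private theorem timeDerivWithin_slice (S : Set ℝ) (U : ℝ → UnitAddTorus (Fin 4) → F) (θ : UnitAddCircle)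
    (t : ℝ) (x : UnitAddTorus (Fin 3)) :
    timeDerivWithin S (fun t' x' => U t' (snocT x' θ)) t x = timeDerivWithin S U t (snocT x θ) :=
  rfl

end Slice

end DimLift

/-! ## (D) the door: `[X₄] → symmHyperbolic_smoothFamilies` -/

/-- **DOOR (PROVED).** Single-datum smooth local existence on `𝕋⁴` implies the smooth-families
statement on `𝕋³` (`Literature.Analysis.PDE.symmHyperbolic_smoothFamilies`, the PreShockHomotopy
input of route OneSphereInfluence): parameter as a fourth space variable — our proof of the
family form of Kato's theorem (smooth dependence on a parameter, Hörmander's parameter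
principle) from the single-datum theorem one dimension up.
[cite: Kato1975, Thms II–III] [cite: Hormander1997, §4.2 p. 54] -/
theorem symmHyperbolic_smoothFamilies_of_dim4 (H4 : SymmHyperbolicLocalExistenceDim 4) :
    symmHyperbolic_smoothFamilies := by
  intro N O A₀ A hO hA0 hA hPD hSy V₀ hV₀ hK
  obtain ⟨K, hKc, hKO, hV₀K⟩ := hK
  -- (A) extend the data family to all parameters
  obtain ⟨W, hW, hWV⟩ := DimLift.exists_isSmoothSpaceTimeOn_univ_extension one_pos hV₀
  -- (B) compact range slightly beyond `[0, 1]`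
  have hWK : ∀ m ∈ Icc (0 : ℝ) 1, ∀ x, W m x ∈ K := fun m hm x => by
    rw [hWV m hm]; exact hV₀K m hm x
  obtain ⟨ε, hε, K', hK'c, hK'O, hWK'⟩ := DimLift.exists_compact_range_nhds hO hKc hKO hW hWK
  -- (C) one datum on `𝕋⁴`
  obtain ⟨U₀, hU₀⟩ : ∃ U₀ : UnitAddTorus (Fin 4) → EuclideanSpace ℝ (Fin N),
      U₀ = fun z => W (DimLift.gPar ε (z (Fin.last 3))) (Fin.init z) := ⟨_, rfl⟩
  have hWc : ContDiff ℝ ∞ (stLift W) := by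
    rw [← contDiffOn_univ, ← univ_prod_univ]; exact hW
  have hG : ContDiff ℝ ∞ (fun y : EuclideanSpace ℝ (Fin 4) =>
      ((1 / 2 + (1 / 2 + ε) * Real.cos (2 * Real.pi * y (Fin.last 3)), DimLift.initE y) :
        ℝ × EuclideanSpace ℝ (Fin 3))) :=
    (contDiff_const.add (contDiff_const.mul (Real.contDiff_cos.comp
      (contDiff_const.mul (contDiff_euclidean.1 contDiff_id (Fin.last 3)))))).prodMk
      DimLift.contDiff_initE
  have hU₀s : IsSmooth U₀ := by
    have hlift : lift U₀ = stLift W ∘ fun y : EuclideanSpace ℝ (Fin 4) =>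
        ((1 / 2 + (1 / 2 + ε) * Real.cos (2 * Real.pi * y (Fin.last 3)), DimLift.initE y) :
          ℝ × EuclideanSpace ℝ (Fin 3)) := by
      funext y
      simp only [lift_apply, hU₀, Function.comp_apply, stLift_apply, DimLift.proj_initE, DimLift.gPar,
        proj_apply, DimLift.cosC_coe]
    show ContDiff ℝ ∞ (lift U₀)
    rw [hlift]
    exact hWc.comp hG
  have hU₀K : ∀ z, U₀ z ∈ K' := fun z => by
    rw [hU₀]; exact hWK' _ (DimLift.gPar_mem hε.le _) _
  obtain ⟨A', hA'⟩ : ∃ A' : Fin 4 → EuclideanSpace ℝ (Fin N) → Matrix (Fin N) (Fin N) ℝ,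
      A' = Fin.snoc A 0 := ⟨_, rfl⟩
  have hA's : ∀ k i j, ContDiffOn ℝ ∞ (fun v => A' k v i j) O := by
    intro k
    refine Fin.lastCases ?_ (fun k' => ?_) k
    · intro i j
      simp only [hA', Fin.snoc_last, Pi.zero_apply, Matrix.zero_apply]
      exact contDiffOn_const
    · intro i j
      simp only [hA', Fin.snoc_castSucc]
      exact hA k' i j
  have hSy' : ∀ k, ∀ v ∈ O, (A' k v).IsSymm := by
    intro k
    refine Fin.lastCases ?_ (fun k' => ?_) k
    · intro v _
      simp only [hA', Fin.snoc_last, Pi.zero_apply]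
      exact Matrix.isSymm_zero
    · intro v hv
      simp only [hA', Fin.snoc_castSucc]
      exact hSy k' v hv
  obtain ⟨T, hT, U, hUs, hU0, hUO, hUeq⟩ :=
    H4 N O A₀ A' hO hA0 hA's hPD hSy' U₀ hU₀s ⟨K', hK'c, hK'O, hU₀K⟩
  -- (D) read the family back on the slices `ϑ = θ_ε(m)`
  have hUc : ContDiffOn ℝ ∞ (stLift U) (Ico 0 T ×ˢ univ) := hUs
  refine ⟨T, hT, fun m t x => U t (DimLift.snocT x (DimLift.thetaC ε m)), fun m hm => ⟨?_, ?_, ?_, ?_⟩, ?_⟩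
  · -- joint smoothness of the slice in `(t, x)`
    have hΨ : ContDiff ℝ ∞ (fun p : ℝ × EuclideanSpace ℝ (Fin 3) =>
        ((p.1, DimLift.snocE p.2 (DimLift.thetaPar ε m)) : ℝ × EuclideanSpace ℝ (Fin 4))) :=
      contDiff_fst.prodMk (DimLift.contDiff_snocE.comp (contDiff_snd.prodMk contDiff_const))
    have hc : ContDiffOn ℝ ∞ (stLift U ∘ fun p : ℝ × EuclideanSpace ℝ (Fin 3) =>
        ((p.1, DimLift.snocE p.2 (DimLift.thetaPar ε m)) : ℝ × EuclideanSpace ℝ (Fin 4)))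
        (Ico 0 T ×ˢ univ) :=
      hUc.comp hΨ.contDiffOn fun p hp => ⟨hp.1, mem_univ _⟩
    refine hc.congr fun p _ => ?_
    show U p.1 (DimLift.snocT (proj p.2) (DimLift.thetaC ε m)) =
      U p.1 (proj (DimLift.snocE p.2 (DimLift.thetaPar ε m)))
    rw [DimLift.proj_snocE_thetaPar]
  · -- initial value
    funext x
    show U 0 (DimLift.snocT x (DimLift.thetaC ε m)) = V₀ m x
    rw [hU0, ← hWV m hm, hU₀]
    show W (DimLift.gPar ε ((DimLift.snocT x (DimLift.thetaC ε m)) (Fin.last 3)))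
      (Fin.init (DimLift.snocT x (DimLift.thetaC ε m))) = W m x
    rw [DimLift.snocT_last, DimLift.init_snocT, DimLift.gPar_thetaC hε.le hm]
  · -- values in `O`
    intro t ht x
    exact hUO t ht _
  · -- the member equation IS the 4-D equation at the slice point (`A₄ ≡ 0`)
    intro t ht x
    have h4 := hUeq t ht (DimLift.snocT x (DimLift.thetaC ε m))
    rw [Fin.sum_univ_castSucc] at h4
    simp only [hA', Fin.snoc_last, Fin.snoc_castSucc, Pi.zero_apply, Matrix.zero_mulVec,
      add_zero] at h4
    simpa only [DimLift.partialDeriv_slice, DimLift.timeDerivWithin_slice] using h4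
  · -- joint smoothness in `(m, t, x)`
    have hθ : ContDiffOn ℝ ∞ (fun q : ℝ × ℝ × EuclideanSpace ℝ (Fin 3) => DimLift.thetaPar ε q.1)
        (Icc 0 1 ×ˢ (Ico 0 T ×ˢ univ)) := fun q hq =>
      ((DimLift.contDiffAt_thetaPar hε hq.1).comp q contDiffAt_fst).contDiffWithinAt
    have hΦ : ContDiffOn ℝ ∞ (fun q : ℝ × ℝ × EuclideanSpace ℝ (Fin 3) =>
        ((q.2.1, DimLift.snocE q.2.2 (DimLift.thetaPar ε q.1)) : ℝ × EuclideanSpace ℝ (Fin 4)))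
        (Icc 0 1 ×ˢ (Ico 0 T ×ˢ univ)) :=
      (contDiff_fst.comp contDiff_snd).contDiffOn.prodMk
        (DimLift.contDiff_snocE.comp_contDiffOn
          ((contDiff_snd.comp contDiff_snd).contDiffOn.prodMk hθ))
    have hc : ContDiffOn ℝ ∞ (stLift U ∘ fun q : ℝ × ℝ × EuclideanSpace ℝ (Fin 3) =>
        ((q.2.1, DimLift.snocE q.2.2 (DimLift.thetaPar ε q.1)) : ℝ × EuclideanSpace ℝ (Fin 4)))
        (Icc 0 1 ×ˢ (Ico 0 T ×ˢ univ)) :=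
      hUc.comp hΦ fun q hq => ⟨hq.2.1, mem_univ _⟩
    refine hc.congr fun q _ => ?_
    show U q.2.1 (DimLift.snocT (proj q.2.2) (DimLift.thetaC ε q.1)) =
      U q.2.1 (proj (DimLift.snocE q.2.2 (DimLift.thetaPar ε q.1)))
    rw [DimLift.proj_snocE_thetaPar]

/-- The same door, packaged at the level of the cell's line of record: `[X₄]` ALONE implies the
hydrodynamic-limit route input `symmHyperbolic_smoothFamilies`; `[X₃]` is a tree theorem.
[cite: Kato1975, Thms II–III] -/
theorem parameterAsDimension_ladder :
    SymmHyperbolicLocalExistenceDim 3 ∧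
      (SymmHyperbolicLocalExistenceDim 4 → symmHyperbolic_smoothFamilies) :=
  ⟨symmHyperbolicLocalExistenceDim_three, symmHyperbolic_smoothFamilies_of_dim4⟩

end Literature.Analysis.PDE

end
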